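import Literature.AlgebraicGeometry.Frobenioids.PadicFrobenioidTwistUnique
import Literature.AlgebraicGeometry.Frobenioids.PadicFrobenioidSectionsNonVacuity
import Literature.AlgebraicGeometry.Frobenioids.PadicFrobenioidQpSplit
import HarnessLib

/-!
# Frobenioids II, Remark 1.2.2 / Remark 1.2.1 / Theorem 1.2 (i): the predicate and schema rows of the
# `p`-adic Frobenioid files — universal closures REFUTED, instance forms PROVED or cited (proof-only)

Mochizuki, *The geometry of Frobenioids II: poly-Frobenioids*, Kyushu J. Math. **62** (2008) 401–460,
§1, Remark 1.2.2, kurims p. 10 [cite: MochizukiFrdII2008, Rmk 1.2.2 p.10]: "one obtains a unique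
automorphism `U` of the data `(Φ, B → Φ^gp)` which is the identity on `O^×(−)` [regarded as a subfunctor
of `B`] and `Φ`, but which maps `τ` … to `u_D · τ`. Thus, `U` induces a self-equivalence `Ψ_U : C ⥲ C` …
a situation which, of course, never arises in conventional scheme theory."

PROOF-ONLY companion of `PadicFrobenioidRmk122.lean` and `PadicFrobenioidThm12.lean` (abc-iut cell, F
fact-proving wave, seat abc-iut-f-046, tranche 46; FACT-LIST rows **F-1182** `PadicFrd.Datum.FixesUnits`,
**F-1184** `PadicFrd.Datum.MapsSplittingTo` — [FrdII] Rmk 1.2.2 p. 10 —, and the schema rows **F-0725**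
`PadicFrd.Rmk121`, **F-1187** `PadicFrd.Thm12_i_standard` — [FrdII] Rmk 1.2.1 p. 10 / Thm 1.2 (i) p. 9 —,
treated in the last section).  The first two declarations are PREDICATES on a
morphism of model data `U : (Φ, B, Div_B) → (Φ, B, Div_B)` (binders: the datum `d`, `U`, and for the
second also the section `u_D` and the family `τ`) — the two defining properties of print's `U` — not
closed statements.  Kernel verdict (rule R5 of plan/FACT-LIST.md: a schema is a fact AT NAMED INSTANCES
ONLY):

* universal closures **REFUTED for every `p`-adic Frobenioid datum** (no hypothesis):
  `not_forall_fixesUnits` — the collapse `U₀ = (1, 1)` (trivial homomorphisms on `Φ` and on `B`; a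
  morphism of the data since `Div_B(1) = 0 = 1^gp(Div_B b)`) moves the unit `u_A ∈ O^×(A)` over
  `1 + p ∈ O_{K_A}^×`, which is `≠ 1` (`exists_unitSection_ne_one`,
  `PadicFrobenioidSectionsNonVacuity.lean`, from abc-iut-L1's `exists_unitSection_onePlusP`); `not_forall_mapsSplittingTo` — the identity `(id_Φ, id_B)` does not
  map the trivial family `τ = 1` (generator `η = id`, `u_η = 1`) to `u_D · τ` for that section; and, in
  print's own setting (`Φ` absolutely primitive, `τ` a characteristic splitting),
  `not_mapsSplittingTo_id` — the identity automorphism of the data never maps `τ` to `u_D · τ` when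
  `u_D ≠ 1` somewhere, although it fixes `O^×(−)` (`fixesUnits_id`): print's `U` is NOT the identity;
* instance forms **PROVED**: `fixesUnits_id`; `exists_isDataAutomorphism_fixesUnits_mapsSplittingTo` /
  `isDataAutomorphism_fixesUnits_mapsSplittingTo_unique` — THE `U` of Remark 1.2.2 (existence and
  uniqueness = seat abc-iut-w5's `rmk122UOfBijective_holds`, `PadicFrobenioidTwistUnique.lean`, under
  reading (R1): bijective pull-backs on `Φ`, `Φ` absolutely primitive) satisfies both predicates.

No definition, no new statement of print; nothing here bears on [IUTchIII] Cor. 3.12 ([FrdII] is a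
refereed preparatory paper; a FACT row is an assumption label, not an endorsement); typed ≠ proved
elsewhere.
-/

namespace Literature.AlgebraicGeometry.Frobenioids

open CategoryTheory Opposite Function

universe w v u

/-- Groupification of the trivial homomorphism is trivial: `(1)^gp = 1`. [folklore] -/
private theorem monGp_map_oneHom {M N : Type w} [CommMonoid M] [CommMonoid N] :
    MonGp.map (1 : M →* N) = 1 :=
  MonGp.hom_ext fun a => by
    rw [MonGp.map_of, MonoidHom.one_apply, MonoidHom.one_apply]
    exact map_one _

namespace PadicFrd

namespace Datum

variable {D : Type u} [Category.{v} D] {p : ℕ} [Fact p.Prime] (d : Datum D p)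

/-! ### F-1182 `FixesUnits`: universal closure refuted, instance forms proved -/

/-- The identity of the data `(Φ, B → Φ^gp)` is a morphism of data: `id^gp ∘ Div_B = Div_B ∘ id`.
[cite: MochizukiFrdII2008, Rmk 1.2.2 p.10] -/
theorem gpApp_id_divB (A : Dᵒᵖ) (b : d.B.obj A) :
    gpApp (𝟙 d.Φ) A (Frobenioids.divB d.Φ d.B d.divB A b) =
      Frobenioids.divB d.Φ d.B d.divB A (((𝟙 d.B : d.B ⟶ d.B).app A).hom b) := by
  change MonGp.map (MonoidHom.id _) (Frobenioids.divB d.Φ d.B d.divB A b) = _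
  rw [MonGp.map_id]
  rfl

/-- **F-1182, instance form PROVED**: the identity automorphism `(id_Φ, id_B)` of the data is the identity
on `O^×(−)` (and is an automorphism of the data which is the identity on `Φ`).
[cite: MochizukiFrdII2008, Rmk 1.2.2 p.10] -/
theorem fixesUnits_id :
    d.IsDataAutomorphism ⟨𝟙 d.Φ, 𝟙 d.B, d.gpApp_id_divB⟩ ∧ d.FixesUnits ⟨𝟙 d.Φ, 𝟙 d.B, d.gpApp_id_divB⟩ :=
  ⟨⟨rfl, fun _ => bijective_id⟩, fun _ _ _ => rfl⟩

/-- **F-1182, universal closure REFUTED for every datum**: NOT every morphism `U` of the data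
`(Φ, B → Φ^gp) → (Φ, B → Φ^gp)` is the identity on `O^×(−)` — the collapse `U₀ = (1, 1)` (trivial
homomorphisms; `Div_B ∘ 1 = 1 = 1^gp ∘ Div_B`) sends the unit `u_A ≠ 1` over `1 + p` to `1`.  So
`FixesUnits` is a genuine CONDITION singling out print's `U`, not a property of all `U`.
[cite: MochizukiFrdII2008, Rmk 1.2.2 p.10] -/
theorem not_forall_fixesUnits : ¬ ∀ U : ModelFrobenioid.DataHom d.divB d.divB, d.FixesUnits U := by
  intro h
  haveI := d.isConnected_base
  obtain ⟨A⟩ := (IsConnected.is_nonempty : Nonempty D)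
  obtain ⟨s, hs⟩ := d.exists_unitSection_ne_one
  -- the collapse endomorphism `U₀ = (1, 1)` of the data
  let η : d.Φ ⟶ d.Φ :=
    { app := fun X => CommMonCat.ofHom (1 : d.Φ.obj X →* d.Φ.obj X)
      naturality := fun X Y f => by
        apply CommMonCat.hom_ext
        apply MonoidHom.ext
        intro x
        simp only [CommMonCat.hom_comp, CommMonCat.hom_ofHom, MonoidHom.comp_apply, MonoidHom.one_apply,
          map_one] }
  let β : d.B ⟶ d.B :=
    { app := fun X => CommMonCat.ofHom (1 : d.B.obj X →* d.B.obj X)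
      naturality := fun X Y f => by
        apply CommMonCat.hom_ext
        apply MonoidHom.ext
        intro x
        simp only [CommMonCat.hom_comp, CommMonCat.hom_ofHom, MonoidHom.comp_apply, MonoidHom.one_apply,
          map_one] }
  have hcomm : ∀ (X : Dᵒᵖ) (b : d.B.obj X),
      gpApp η X (Frobenioids.divB d.Φ d.B d.divB X b) = Frobenioids.divB d.Φ d.B d.divB X ((β.app X).hom b) := by
    intro X b
    change MonGp.map (CommMonCat.ofHom (1 : d.Φ.obj X →* d.Φ.obj X)).hom _ =
      Frobenioids.divB d.Φ d.B d.divB X ((CommMonCat.ofHom (1 : d.B.obj X →* d.B.obj X)).hom b)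
    rw [CommMonCat.hom_ofHom, CommMonCat.hom_ofHom, monGp_map_oneHom, MonoidHom.one_apply,
      MonoidHom.one_apply, map_one]
  have hfix := h ⟨η, β, hcomm⟩ (op A) (s.u A) (s.divB_u A)
  change (CommMonCat.ofHom (1 : d.B.obj (op A) →* d.B.obj (op A))).hom (s.u A) = s.u A at hfix
  rw [CommMonCat.hom_ofHom, MonoidHom.one_apply] at hfix
  exact hs A hfix.symm

/-- **F-1182, fully closed form REFUTED**: the universal closure over ALL binders (base category, prime,
datum, `U`) fails — at any datum at all, e.g. at `C^⊢(ℚ_2)` (`Datum.primQp 2`). [cite: MochizukiFrdII2008, Rmk 1.2.2 p.10] -/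
theorem not_forall_datum_fixesUnits :
    ¬ ∀ (D : Type) [Category.{0} D] (p : ℕ) [Fact p.Prime] (d : Datum D p)
        (U : ModelFrobenioid.DataHom d.divB d.divB), d.FixesUnits U :=
  fun h => (Datum.primQp 2).not_forall_fixesUnits (h _ 2 _)

/-! ### F-1184 `MapsSplittingTo`: universal closure refuted, instance forms proved -/

/-- The identity endomorphism generates the trivial submonoid `1 ⊆ End(X)`. [folklore] -/
private theorem isGeneratorOf_one_bot {M : Type*} [Monoid M] : IsGeneratorOf (1 : M) (⊥ : Submonoid M) :=
  ⟨Submonoid.one_mem _, fun s hs => ⟨0, by rw [Submonoid.mem_bot] at hs; rw [hs, pow_zero]⟩⟩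

/-- **F-1184, universal closure REFUTED for every datum**: NOT every triple `(U, u_D, τ)` has "`U` maps `τ`
to `u_D · τ`" — the identity `(id_Φ, id_B)`, the nowhere-trivial section over `1 + p` and the trivial
family `τ(X) = 1` (generated by `η = id_X`, rational function `u_η = 1`): the predicate would force
`1 = 1 · u_A`, i.e. `u_A = 1`.  So `MapsSplittingTo` is a genuine CONDITION on `U`.
[cite: MochizukiFrdII2008, Rmk 1.2.2 p.10] -/
theorem not_forall_mapsSplittingTo :
    ¬ ∀ (U : ModelFrobenioid.DataHom d.divB d.divB) (s : d.UnitSection)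
        (τ : ∀ X : d.frobenioid, Submonoid (End X)), d.MapsSplittingTo U s τ := by
  intro h
  haveI := d.isConnected_base
  obtain ⟨A⟩ := (IsConnected.is_nonempty : Nonempty D)
  obtain ⟨s, hs⟩ := d.exists_unitSection_ne_one
  have hmaps := h ⟨𝟙 d.Φ, 𝟙 d.B, d.gpApp_id_divB⟩ s (fun _ => ⊥)
    (ModelFrobenioid.zeroObj d.Φ d.B d.divB A) 1 isGeneratorOf_one_bot
  change ModelFrobenioid.unit (𝟙 (ModelFrobenioid.zeroObj d.Φ d.B d.divB A)) =
    ModelFrobenioid.unit (𝟙 (ModelFrobenioid.zeroObj d.Φ d.B d.divB A)) * s.u A at hmaps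
  rw [ModelFrobenioid.unit_id, one_mul] at hmaps
  exact hs A hmaps.symm

/-- **F-1184, fully closed form REFUTED**: the universal closure over ALL binders fails (at `C^⊢(ℚ_2)`).
[cite: MochizukiFrdII2008, Rmk 1.2.2 p.10] -/
theorem not_forall_datum_mapsSplittingTo :
    ¬ ∀ (D : Type) [Category.{0} D] (p : ℕ) [Fact p.Prime] (d : Datum D p)
        (U : ModelFrobenioid.DataHom d.divB d.divB) (s : d.UnitSection)
        (τ : ∀ X : d.frobenioid, Submonoid (End X)), d.MapsSplittingTo U s τ :=
  fun h => (Datum.primQp 2).not_forall_mapsSplittingTo (h _ 2 _)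

/-- **In print's setting the identity is NOT print's `U`**: for `Φ` absolutely primitive, a characteristic
splitting `τ` on `C` and a section `u_D` of `O^×(−)` with `u_A ≠ 1` for some `A`, the identity
automorphism of the data (which fixes `O^×(−)`, `fixesUnits_id`) does not map `τ` to `u_D · τ`: at a
generator `η` of `τ((A, 0))` (abc-iut-w5's `exists_isGeneratorOf_τ`) it would force `u_η = u_η · u_A`.
This is the kernel form of "`p ↦ p · u` … never arises in conventional scheme theory": the twist is a
non-identity automorphism of the data. [cite: MochizukiFrdII2008, Rmk 1.2.2 p.10] -/
theorem not_mapsSplittingTo_id (hap : d.IsAbsolutelyPrimitive)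
    (T : PreFrobenioid.CharacteristicSplitting d.structureFunctor) (s : d.UnitSection)
    (hs : ∃ A : D, s.u A ≠ 1) :
    ¬ d.MapsSplittingTo ⟨𝟙 d.Φ, 𝟙 d.B, d.gpApp_id_divB⟩ s T.τ := by
  intro h
  obtain ⟨A, hA⟩ := hs
  obtain ⟨η, hη⟩ := d.exists_isGeneratorOf_τ T hap (ModelFrobenioid.zeroObj d.Φ d.B d.divB A)
  have hmaps := h (ModelFrobenioid.zeroObj d.Φ d.B d.divB A) η hη
  change ModelFrobenioid.unit (End.asHom η) = ModelFrobenioid.unit (End.asHom η) * s.u A at hmaps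
  exact hA ((d.isUnit_B (op A) _).mul_eq_left.mp hmaps.symm)

/-- **For every absolutely primitive datum and every characteristic splitting, `MapsSplittingTo` fails
for SOME admissible `(U, u_D)`** (the identity and the section over `1 + p`), hypothesis-free in `u_D`.
[cite: MochizukiFrdII2008, Rmk 1.2.2 p.10] -/
theorem exists_not_mapsSplittingTo (hap : d.IsAbsolutelyPrimitive)
    (T : PreFrobenioid.CharacteristicSplitting d.structureFunctor) :
    ∃ (U : ModelFrobenioid.DataHom d.divB d.divB) (s : d.UnitSection),
      d.IsDataAutomorphism U ∧ d.FixesUnits U ∧ ¬ d.MapsSplittingTo U s T.τ := by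
  haveI := d.isConnected_base
  obtain ⟨A⟩ := (IsConnected.is_nonempty : Nonempty D)
  obtain ⟨s, hs⟩ := d.exists_unitSection_ne_one
  exact ⟨_, s, d.fixesUnits_id.1, d.fixesUnits_id.2, d.not_mapsSplittingTo_id hap T s ⟨A, hs A⟩⟩

/-- **F-1182 / F-1184, instance forms PROVED — THE `U` of Remark 1.2.2**: for an absolutely primitive
datum whose pull-back maps on `Φ` are bijective (reading (R1) of `PadicFrobenioidRmk122.lean`), every
section `u_D` of `O^×(−)` and every characteristic splitting `τ`, there IS an automorphism `U` of the data,
the identity on `Φ`, which is the identity on `O^×(−)` AND maps `τ` to `u_D · τ` (existence half of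
abc-iut-w5's `rmk122UOfBijective_holds`: `β_A(b) = b · u_A^{m_A(b)}`). [cite: MochizukiFrdII2008, Rmk 1.2.2 p.10] -/
theorem exists_isDataAutomorphism_fixesUnits_mapsSplittingTo (hbij : d.HasBijectivePullbacks)
    (hap : d.IsAbsolutelyPrimitive) (s : d.UnitSection)
    (T : PreFrobenioid.CharacteristicSplitting d.structureFunctor) :
    ∃ U : ModelFrobenioid.DataHom d.divB d.divB,
      d.IsDataAutomorphism U ∧ d.FixesUnits U ∧ d.MapsSplittingTo U s T.τ :=
  (d.rmk122UOfBijective_holds hbij hap s T).exists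

/-- **F-1182 / F-1184, the two predicates DETERMINE `U`**: two automorphisms of the data, both the identity
on `Φ` and on `O^×(−)` and both mapping `τ` to `u_D · τ`, coincide (uniqueness half of
`rmk122UOfBijective_holds`: `B(A) = O^×(A) · u_η^ℤ`). [cite: MochizukiFrdII2008, Rmk 1.2.2 p.10] -/
theorem isDataAutomorphism_fixesUnits_mapsSplittingTo_unique (hbij : d.HasBijectivePullbacks)
    (hap : d.IsAbsolutelyPrimitive) (s : d.UnitSection)
    (T : PreFrobenioid.CharacteristicSplitting d.structureFunctor)
    {U U' : ModelFrobenioid.DataHom d.divB d.divB}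
    (hU : d.IsDataAutomorphism U ∧ d.FixesUnits U ∧ d.MapsSplittingTo U s T.τ)
    (hU' : d.IsDataAutomorphism U' ∧ d.FixesUnits U' ∧ d.MapsSplittingTo U' s T.τ) : U = U' :=
  (d.rmk122UOfBijective_holds hbij hap s T).unique hU hU'

/-- **Print's `U` is not the identity** (for `u_D` somewhere `≠ 1`): THE automorphism of
`exists_isDataAutomorphism_fixesUnits_mapsSplittingTo` differs from `(id_Φ, id_B)`.
[cite: MochizukiFrdII2008, Rmk 1.2.2 p.10] -/
theorem rmk122U_ne_id (hap : d.IsAbsolutelyPrimitive) (s : d.UnitSection) (hs : ∃ A : D, s.u A ≠ 1)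
    (T : PreFrobenioid.CharacteristicSplitting d.structureFunctor)
    {U : ModelFrobenioid.DataHom d.divB d.divB} (hU : d.MapsSplittingTo U s T.τ) :
    U ≠ ⟨𝟙 d.Φ, 𝟙 d.B, d.gpApp_id_divB⟩ := by
  rintro rfl
  exact d.not_mapsSplittingTo_id hap T s hs hU

/-! ### F-0725 `Rmk121`, F-1187 `Thm12_i_standard`: schemas over the free vocabulary record `V`

`PadicFrd.Rmk121 d V` and `PadicFrd.Thm12_i_standard d V` (seat abc-iut-L1-t4, `PadicFrobenioidThm12.lean`,
SCHEMA NOTICE RQ7 N1) quantify over an ARBITRARY record `V : Thm12Vocab d` of `Prop`-valued slots; their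
conclusions are slots of `V`.  Hence the universal closure over `V` fails EXACTLY when print's hypothesis
holds (take every slot `:= False`), in particular at `C^⊢(ℚ_p)`; the rows are facts AT THE BOUND SLOTS
ONLY, where they are ALREADY PROVED in the tree and are cited, not re-proved: F-0725 ⇐
`Datum.rmk121_bindFrobenius_holds` (p415370, `PadicFrobenioidRmk121Holds.lean`: `Rmk121 d V.bindFrobenius`
for `Φ`, `B` monoids on `D`; premise-free over FSM-type bases `rmk121_bindFrobenius_holds_of_isOfFSMType`;
at `C^⊢(ℚ_p)` with NO hypothesis `rmk121_primQp`, `PadicFrobenioidQpFrobeniusFunctors.lean`); F-1187 ⇐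
`Datum.thm12_i_standard_rsParams` (p418625, `PadicFrobenioidFrobeniusCompact.lean`: `Thm12_i_standard d V`
for every `V` whose rationally-standard slot is implied by [FrdI] Def. 4.5 (iii) at THE parameters;
premise-free over FSM-type bases `thm12_i_standard_rsParams_of_isOfFSMType`) and
`Thm12_i_standard_of_inputs` (`PadicFrobenioidRationalData.lean`). -/

/-- **F-0725, universal closure over `V` REFUTED ⟺ print's hypothesis**: "Remark 1.2.1 for EVERY
vocabulary record `V`" fails iff `Φ` is absolutely primitive (the record with all slots `False`
refutes it; if `Φ` is not absolutely primitive every instance holds vacuously).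
[cite: MochizukiFrdII2008, Rmk 1.2.1 p.10] -/
theorem not_forall_rmk121_iff : (¬ ∀ V : Thm12Vocab d, Rmk121 d V) ↔ d.IsAbsolutelyPrimitive := by
  refine ⟨fun h => ?_, fun hap h => (h ⟨False, False, fun _ => False, False, False, False⟩ hap).1⟩
  by_contra hap
  refine h fun V => ?_
  intro h'
  exact (hap h').elim

/-- **F-1187, universal closure over `V` REFUTED ⟺ print's hypothesis**: "Theorem 1.2 (i), third
sentence, for EVERY vocabulary record `V`" fails iff `D` is of FSMFF-type.
[cite: MochizukiFrdII2008, Thm 1.2 (i) p.9] -/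
theorem not_forall_thm12_i_standard_iff :
    (¬ ∀ V : Thm12Vocab d, Thm12_i_standard d V) ↔ IsOfFSMFFType D := by
  refine ⟨fun h => ?_, fun hD h => h ⟨False, False, fun _ => False, False, False, False⟩ hD⟩
  by_contra hD
  refine h fun V => ?_
  intro h'
  exact (hD h').elim

end Datum

/-! ### The same at `C^⊢(ℚ_p)` and in fully closed form -/

section Qp

variable (p : ℕ) [Fact p.Prime]

/-- **F-0725 REFUTED at `C^⊢(ℚ_p)`** (`Φ = ord(ℤ_p^⊳)` IS absolutely primitive, `primQp_isAbsolutelyPrimitive`):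
not every vocabulary record satisfies Remark 1.2.1 there. [cite: MochizukiFrdII2008, Rmk 1.2.1 p.10] -/
theorem not_forall_rmk121_primQp : ¬ ∀ V : Thm12Vocab (Datum.primQp p), Rmk121 (Datum.primQp p) V :=
  (Datum.primQp p).not_forall_rmk121_iff.mpr (primQp_isAbsolutelyPrimitive p)

/-- **F-1187 REFUTED at `C^⊢(ℚ_p)`** (the one-object base IS of FSMFF-type, being of FSM-type,
`isOfFSMType_discretePUnit`): not every vocabulary record satisfies Theorem 1.2 (i), third sentence, there.
[cite: MochizukiFrdII2008, Thm 1.2 (i) p.9] -/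
theorem not_forall_thm12_i_standard_primQp :
    ¬ ∀ V : Thm12Vocab (Datum.primQp p), Thm12_i_standard (Datum.primQp p) V :=
  (Datum.primQp p).not_forall_thm12_i_standard_iff.mpr (isOfFSMType_discretePUnit).isOfFSMFFType

/-- **F-0725, fully closed form REFUTED** (all binders universal; witness `C^⊢(ℚ_2)`).
[cite: MochizukiFrdII2008, Rmk 1.2.1 p.10] -/
theorem not_forall_datum_rmk121 :
    ¬ ∀ (D : Type) [Category.{0} D] (p : ℕ) [Fact p.Prime] (d : Datum D p) (V : Thm12Vocab d),
        Rmk121 d V :=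
  fun h => not_forall_rmk121_primQp 2 (h _ 2 _)

/-- **F-1187, fully closed form REFUTED** (all binders universal; witness `C^⊢(ℚ_2)`).
[cite: MochizukiFrdII2008, Thm 1.2 (i) p.9] -/
theorem not_forall_datum_thm12_i_standard :
    ¬ ∀ (D : Type) [Category.{0} D] (p : ℕ) [Fact p.Prime] (d : Datum D p) (V : Thm12Vocab d),
        Thm12_i_standard d V :=
  fun h => not_forall_thm12_i_standard_primQp 2 (h _ 2 _)

/-- **F-1182 / F-1184 at `C^⊢(ℚ_p)`, hypothesis-free instance form**: over the one-object base every
pull-back of `Φ` is bijective and `Φ` is absolutely primitive, so for EVERY section `u_D` of `O^×(−)` and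
the splitting `τ_p` (`τQp`) THE automorphism `U` of Remark 1.2.2 — identity on `Φ` and on `O^×(−)`,
mapping `τ_p` to `u_D · τ_p` — exists and is unique. [cite: MochizukiFrdII2008, Rmk 1.2.2 p.10] -/
theorem existsUnique_rmk122U_primQp (s : (Datum.primQp p).UnitSection) :
    ∃! U : ModelFrobenioid.DataHom (Datum.primQp p).divB (Datum.primQp p).divB,
      (Datum.primQp p).IsDataAutomorphism U ∧ (Datum.primQp p).FixesUnits U ∧
        (Datum.primQp p).MapsSplittingTo U s (τQp p).τ := by
  refine (Datum.primQp p).rmk122UOfBijective_holds (fun {A A'} f => ?_) (primQp_isAbsolutelyPrimitive p)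
    s (τQp p)
  obtain ⟨⟨⟩⟩ := A
  obtain ⟨⟨⟩⟩ := A'
  have hf : f = 𝟙 _ := Subsingleton.elim _ _
  subst hf
  rw [op_id, (Datum.primQp p).Φ.map_id]
  exact bijective_id

end Qp

end PadicFrd

end Literature.AlgebraicGeometry.Frobenioids
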